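import Summits.BirchSwinnertonDyer.BirchSwinnertonDyer.Theorems.RamifiedHeegnerPairLeafRankOneUpperAtThreeOfNamedFacts
import Summits.BirchSwinnertonDyer.BirchSwinnertonDyer.Theorems.RamifiedHeegnerPairLeafJetchevReadingAnyCarrier
import HarnessLib

/-!
# Route `RamifiedHeegnerPair`, crux U₁ `LeafRankOneUpperAtThree` (stmt-BirchSwinnertonDyer-26022), line `splitkolyvagin` —
# the reading-grade rows WIDEN to the mono-carrier rows of ANY reduction type: U₁ ⟸ PUB⁺ ∧ three named facts ∧ Σ★‴ ∧ L₀,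
# where Σ★‴ = the research residue Σ★″ (item 27493) asked only OFF the mono-carrier rows (one prime `q ∣ N_E`, of any
# reduction type, carrying the whole `3`-part of `∏ c_ℓ`) — Σ★‴ is implied by 27493

HONEST FRAMING. Theorems only; helper file (`--supports stmt-BirchSwinnertonDyer-26022 --as helper`); nothing is booked,
no item is closed, BSD is not proved for any curve; CONDITIONAL on every displayed input. Lead prover bsd-line-rhp-p2 g9,
2026-08-28.

THE MOVE. The sibling `…LeafJetchevReadingAnyCarrier` (this seat) proves the Jetchev reading at an ARBITRARY carrier
`q ∣ N_E` from {Gross 3.7 (2), Poitou–Tate, [GZ86 III (3.1)] image-free} (R|₂, `anyCarrierTwoSplitReading_of_namedFacts`):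
the «`q ∥ N`» and «every Tamagawa-`3` carrier multiplicative» binders of S2 (27492) were idle in `bsd-potss`'s proof. So the
U₁ compositions of record (p638868 §2, p639230 §4–§6) re-run with the mono-MULTIPLICATIVE-carrier row predicate
`(∃ q ∥ N, ord₃ ∏c ≤ ord₃ c_q) ∧ (carriers multiplicative)` replaced by the MONO-CARRIER predicate `∃ q ∣ N, ord₃ ∏c ≤ ord₃ c_q`
(any reduction type at `q`). Census reading (pss CENSUS/additive_classes_v2, rank-one Gss2, N < 5·10⁵): single-carrier rows
108 = 99 mono-multiplicative (already reading grade) + 9 with one ADDITIVE carrier (Kodaira IV/IV*, `c_q = 3`) — the 9 move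
from the residue to reading grade; the residue Σ★‴ is the 238 multi-carrier rows (Jetchev-max barrier, S2-EXIT-g8.md §4).

* §1 `leafRankOneUpper_three_monoCarrierAny_of_anyCarrierReading_of_lowerRankZero` — U₁ at `W` on ONE mono-carrier row
  (carrier `q ∣ N_E` of any type) from print + R|₂ + L₀ + a datum with `3 ∤ c` (p638868 §2 re-run; no `q ∥ N`, no
  multiplicativity, no `q ≠ 3` step).
* §2 `leafRankOneUpper_three_of_latticeOptimal_of_anyCarrierReading_of_sigmaOptOffMonoRows_of_lowerRankZero` — U₁ at a
  leaf curve carrying a lattice-optimal datum ⟸ print + R|₂ + Σ‴ + L₀ (p639230 §4 re-run with the widened predicate).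
* §3 `leafRankOneUpperAtThree_of_pubManin_of_anyCarrierReading_of_sigmaOptOffMonoRows_of_lowerRankZero` — the route decl
  from PUB⁺ (27491 BY NAME) + R|₂ + Σ‴ + L₀ via the optimal member (p639230 §5 re-run).
* §4 `sigmaOptOffMonoRows_of_sigmaStarOptOffMonoRows` (Σ★‴ ⟹ Σ‴), `sigmaStarOptOffMonoRows_of_sigmaStarOptOffRows`
  (**Σ★″ ⟹ Σ★‴**: item 27493 implies the new residue — it is asked on fewer rows).
* §5 HEADLINE `leafRankOneUpperAtThree_of_pubManin_of_namedFacts_of_sigmaStarOptOffMonoRows_of_lowerRankZero` —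
  **`LeafRankOneUpperAtThree` ⟸ `LeafRankOnePrintedInputsAtThree` ∧ F1 ∧ F2 ∧ F3 ∧ Σ★‴ ∧ `Gss2LowerAtThreeRankZero`**
  (skeleton v8's composition). With §4 the headline of p639230 (… ∧ Σ★″ ∧ …) is recovered.

References: [cite: Jetchev2008, Thm. 1.4 (ii), Cor. 1.5, Conj. 1.3 (p. 812)] [cite: GrossLMS1991, Prop. 3.7 (2) (p. 240), §6 p. 245]
[cite: MilneADT2006, Ch. I, Thm. 4.10(b)] [cite: GrossZagier1986, III (3.1); Thm. I.(6.3) and (7.3)] [cite: MatarNekovar2019, Thm. 0.7 (p. 456)]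
[cite: FriedbergHoffstein1995, Thm. B] [cite: Mazur1978, Cor. 4.1] [cite: Stevens1989, Lemmas (5.2), (5.4)] [cite: Miller2011LMS, Def. 1.1].
-/

-- D-0017: single-problem summit, so `Summit.BirchSwinnertonDyer.BirchSwinnertonDyer.…` repeats a namespace BY DESIGN.
set_option linter.dupNamespace false
set_option autoImplicit false

noncomputable section

open scoped Classical NumberField

open WeierstrassCurve IsDedekindDomain IsDedekindDomain.HeightOneSpectrum NumberField
  Rat.HeightOneSpectrum Literature Literature.NumberTheory.EllipticCurves
  Literature.NumberTheory.EllipticCurves.ModularForms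
  Literature.NumberTheory.EllipticCurves.Rank1Residual
  Literature.NumberTheory.EllipticCurves.Rank1Residual.Typed
  Literature.NumberTheory.EllipticCurves.KrizLi2019
  Literature.NumberTheory.QuadraticFields
  Summit.BirchSwinnertonDyer.Rank1Residual
  Summit.BirchSwinnertonDyer.Rank1Residual.Additive
  Summit.BirchSwinnertonDyer.Rank1Residual.X11b.Three
  Summit.BirchSwinnertonDyer.BirchSwinnertonDyer.Theses.RamifiedHeegnerPair
  Summit.BirchSwinnertonDyer.BirchSwinnertonDyer.Theorems
  Summit.BirchSwinnertonDyer.BirchSwinnertonDyer.Theorems.SchneiderFree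
  Summit.BirchSwinnertonDyer.BirchSwinnertonDyer.Theorems.JetchevReadingAnyCarrier

namespace Summit.BirchSwinnertonDyer.BirchSwinnertonDyer.Theorems.RamifiedPairUpperBound

/-! ## §1 One datum on a mono-carrier row of ANY reduction type: Σ at the datum is the any-carrier reading R|₂ -/

/-- **U₁ ON ONE MONO-CARRIER ROW (carrier of ANY reduction type) from the any-carrier 2-SPLIT READING R|₂** — p638868's
`leafRankOneUpper_three_monoCarrier_of_twoSplitReading_of_lowerRankZero` with S2|₂ replaced by R|₂ (`hR₂`, the conclusion of
`JetchevReadingAnyCarrier.anyCarrierTwoSplitReading_of_namedFacts`): the carrier is any prime `q ∣ N_E` with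
`ord₃ ∏ c_ℓ(W) ≤ ord₃ c_q(W)`; NO `q ∥ N`, NO «carriers multiplicative». `W/ℚ` globally minimal, non-CM, leaf Gss2 at `3`,
`r_an(W) = 1`, a datum `Dt` with `3 ∤ c(Dt)`; OUTPUT `Typed.MissingUpperBoundAt W 3`. Proof as there, through p638868 §1
(Friedberg–Hoffstein field with `2` split), minus the `q ≠ 3` step. CONDITIONAL on `hR₂`, the named facts and L₀; nothing
asserted about any curve. [cite: Jetchev2008, Thm. 1.4 and Cor. 1.5 (p. 812)] [cite: MatarNekovar2019, Thm. 0.7 (p. 456)]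
[cite: FriedbergHoffstein1995, Thm. B] [cite: GrossZagier1986, Thm. I.(6.3) and (7.3)] [cite: Miller2011LMS, Def. 1.1] -/
theorem leafRankOneUpper_three_monoCarrierAny_of_anyCarrierReading_of_lowerRankZero
    (hGZ : ∀ (N : ℕ) [NeZero N] (W : WeierstrassCurve ℚ) (K : Type) [Field K] [NumberField K],
      gross_zagier N W K)
    (hKo : ∀ (N : ℕ) [NeZero N] (W : WeierstrassCurve ℚ) (K : Type) [Field K] [NumberField K],
      kolyvagin N W K)
    (hGZK : rank_eq_analyticRank_of_analyticRank_le_one) (hmod : hasEntireLFunction_rat)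
    (hGZ73 : GrossZagier1986_thm_I_7_3)
    (hMN : MatarNekovar2019.thm07_padicValNat_card_sha_primary_add_le_of_globalDivisibility_of_irreducible)
    (hnf : exists_isNewformOf) (hFH : friedbergHoffstein_exists_heegnerField_splitDivisors_twist_ne_zero)
    (hR₂ : ∀ (W : WeierstrassCurve ℚ) [W.IsElliptic] [W.IsGloballyMinimal] [NeZero (W.conductorNorm ℤ)],
      ¬ W.HasCM →
      ∀ (K : Type) [Field K] [NumberField K], IsImaginaryQuadratic K →
      NumberField.discr K ≠ -3 → NumberField.discr K ≠ -4 →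
      SatisfiesHeegnerHypothesis (W.conductorNorm ℤ) K → SatisfiesHeegnerHypothesis 2 K →
      ∀ (p : ℕ) [Fact p.Prime], p ≠ 2 → Addv W p → W.HasIrreducibleModPGaloisRep p →
      ∀ (Dt : ModularParametrizationData W (W.conductorNorm ℤ)) (β : ℤ) (ι : K →+* ℂ)
        (d₁ : KolyvaginHeegnerData Dt β ι 1), ¬ IsOfFinAddOrder d₁.derivedPoint →
      ∀ (q : ℕ) [Fact q.Prime], q ∣ W.conductorNorm ℤ →
      ∀ (s : ℕ), s ≤ padicValNat p ((W.baseChange ℚ_[q]).localTamagawaNumber ℤ_[q]) →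
        ∀ (n : ℕ) (d : KolyvaginHeegnerData Dt β ι n), Squarefree n →
          (∀ ℓ ∈ n.primeFactors, Zhang2014.IsKolyvaginPrime (W.conductorNorm ℤ) W K p ℓ ∧
            s ≤ Zhang2014.kolyvaginIndex W p ℓ) →
          ∃ Q : (W.baseChange (ringClassField K ι n)).toAffine.Point,
            ((p ^ s : ℕ) : ℤ) • Q = d.derivedPoint)
    (hL0 : Gss2LowerAtThreeRankZero)
    (W : WeierstrassCurve ℚ) [W.IsElliptic] [W.IsGloballyMinimal] [NeZero (W.conductorNorm ℤ)]
    (hCM : ¬ W.HasCM) (hadd : Addv W 3) (hsub : SubGss W 3) (hr : W.analyticRank = 1)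
    (q : ℕ) [Fact q.Prime] (hqN : q ∣ W.conductorNorm ℤ)
    (hmono : padicValNat 3 W.tamagawaProduct ≤ padicValNat 3 ((W.baseChange ℚ_[q]).localTamagawaNumber ℤ_[q]))
    (Dt : ModularParametrizationData W (W.conductorNorm ℤ)) (hc : ¬ (3 : ℤ) ∣ Dt.c) :
    MissingUpperBoundAt W 3 := by
  -- the leaf discharges the reading's binders at `p = 3`
  have hirr : W.HasIrreducibleModPGaloisRep 3 := (classX4_three_of_addv_of_subGss W hadd hsub).2.2
  have h3N : 3 ∣ W.conductorNorm ℤ :=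
    (W.dvd_conductorNorm_iff_not_hasGoodReductionAtPrime 3).mpr (not_good_of_addv W 3 hadd)
  have hc0 : padicValNat 3 Dt.c.natAbs = 0 :=
    padicValNat.eq_zero_of_not_dvd fun h ↦ hc (Int.ofNat_dvd_left.mpr h)
  refine leafRankOneUpper_three_of_sigmaAtDatumTwoSplit_of_lowerRankZero hGZ hKo hGZK hmod hGZ73 hMN hnf hFH hL0 W hCM
    hadd hsub hr Dt ?_
  intro K _ _ H ι P hK hHN hH2 hLt hP hnt hodd s' hs' n d hn hℓ
  -- the whole budget sits at the carrier `q`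
  have hsq : s' ≤ padicValNat 3 ((W.baseChange ℚ_[q]).localTamagawaNumber ℤ_[q]) := by omega
  -- `d_K ∉ {-3, -4}`: `3 ∣ N_E` splits in `K`, `d_K` odd
  have h3 : NumberField.discr K ≠ -3 := by
    intro h
    exact (X11b.Three.not_dvd_discr_and_not_dvd_torsionOrder_of_heegner hK hHN (by decide) h3N).1
      (h ▸ ⟨-1, by norm_num⟩)
  have h4 : NumberField.discr K ≠ -4 := by
    intro h
    rw [h] at hodd
    exact (Int.not_odd_iff_even.mpr ⟨-2, by norm_num⟩) hodd
  -- the conductor-`1` Kolyvagin–Heegner datum on the frame, with bottom point `P` (Darmon 3.6 / Shimura, proved)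
  obtain ⟨d₁⟩ := exists_kolyvaginHeegnerData_one
    (phi_heegnerTau_mem_singularModuliField_holds (W.conductorNorm ℤ) W K) hK Dt H.β ι H.dvd_sq_sub
  have hPd : d₁.toGeomPoints d₁.derivedPoint = toGeomPoints (W.baseChange K) P :=
    X11b.KolyvaginBottom.toGeomPoints_derivedPoint_one_eq
      (heegnerPointOfConductor_one_galoisConj_holds (W.conductorNorm ℤ) W K) hK hHN hP d₁ rfl
  have hy₁ : ¬ IsOfFinAddOrder d₁.derivedPoint := by
    intro hfin
    apply hnt
    have h1 : IsOfFinAddOrder (d₁.toGeomPoints d₁.derivedPoint) := d₁.toGeomPoints.isOfFinAddOrder hfin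
    rw [hPd] at h1
    exact (toGeomPoints_injective (W.baseChange K)).isOfFinAddOrder_iff.mp h1
  -- R|₂ at `p = 3`, carrier `q`, depth `s'`, in the field `K` in which `2` splits
  exact hR₂ W hCM K hK h3 h4 hHN hH2 3 (by decide) hadd hirr Dt H.β ι d₁ hy₁ q hqN s' hsq n d hn hℓ

/-! ## §2 U₁ at a leaf curve carrying a lattice-optimal datum ⟸ print + R|₂ + Σ‴ + L₀ -/

/-- **U₁ AT A LEAF CURVE CARRYING A LATTICE-OPTIMAL DATUM, from print + R|₂ + Σ‴ + L₀** — p639230 §4 with the row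
predicate WIDENED to the mono-carrier rows of any reduction type: ON a row `∃ q ∣ N_E, ord₃ ∏c ≤ ord₃ c_q` use §1 at the
datum itself (`3 ∤ c` by `not_three_dvd_c_of_latticeOptimal_of_subGss`, Manin facts); OFF those rows the research input Σ‴
(= Σ″ with the widened predicate) feeds p610955's `leafRankOneUpper_three_of_sigmaAtDatum_of_lowerRankZero`. CONDITIONAL on
every displayed input; nothing asserted about any curve. [cite: Jetchev2008, Thm. 1.4, Cor. 1.5, Conj. 1.3 (p. 812)]
[cite: Mazur1978, Cor. 4.1] [cite: Stevens1989, Lemmas (5.2), (5.4)] [cite: MatarNekovar2019, Thm. 0.7 (p. 456)]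
[cite: FriedbergHoffstein1995, Thm. B] [cite: GrossZagier1986, Thm. I.(6.3) and (7.3)] [cite: Miller2011LMS, Def. 1.1] -/
theorem leafRankOneUpper_three_of_latticeOptimal_of_anyCarrierReading_of_sigmaOptOffMonoRows_of_lowerRankZero
    (hGZ : ∀ (N : ℕ) [NeZero N] (W : WeierstrassCurve ℚ) (K : Type) [Field K] [NumberField K],
      gross_zagier N W K)
    (hKo : ∀ (N : ℕ) [NeZero N] (W : WeierstrassCurve ℚ) (K : Type) [Field K] [NumberField K],
      kolyvagin N W K)
    (hGZK : rank_eq_analyticRank_of_analyticRank_le_one) (hmod : hasEntireLFunction_rat)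
    (hGZ73 : GrossZagier1986_thm_I_7_3)
    (hMN : MatarNekovar2019.thm07_padicValNat_card_sha_primary_add_le_of_globalDivisibility_of_irreducible)
    (hnf : exists_isNewformOf) (hFH : friedbergHoffstein_exists_heegnerField_splitDivisors_twist_ne_zero)
    (hM : mazur_not_dvd_maninConstant_of_odd) (hAU : abbesUllmo_not_dvd_maninConstant_of_not_dvd_level)
    (hC2 : cesnavicius_not_two_dvd_maninConstant_of_two_dvd_level)
    (hR₂ : ∀ (W : WeierstrassCurve ℚ) [W.IsElliptic] [W.IsGloballyMinimal] [NeZero (W.conductorNorm ℤ)],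
      ¬ W.HasCM →
      ∀ (K : Type) [Field K] [NumberField K], IsImaginaryQuadratic K →
      NumberField.discr K ≠ -3 → NumberField.discr K ≠ -4 →
      SatisfiesHeegnerHypothesis (W.conductorNorm ℤ) K → SatisfiesHeegnerHypothesis 2 K →
      ∀ (p : ℕ) [Fact p.Prime], p ≠ 2 → Addv W p → W.HasIrreducibleModPGaloisRep p →
      ∀ (Dt : ModularParametrizationData W (W.conductorNorm ℤ)) (β : ℤ) (ι : K →+* ℂ)
        (d₁ : KolyvaginHeegnerData Dt β ι 1), ¬ IsOfFinAddOrder d₁.derivedPoint →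
      ∀ (q : ℕ) [Fact q.Prime], q ∣ W.conductorNorm ℤ →
      ∀ (s : ℕ), s ≤ padicValNat p ((W.baseChange ℚ_[q]).localTamagawaNumber ℤ_[q]) →
        ∀ (n : ℕ) (d : KolyvaginHeegnerData Dt β ι n), Squarefree n →
          (∀ ℓ ∈ n.primeFactors, Zhang2014.IsKolyvaginPrime (W.conductorNorm ℤ) W K p ℓ ∧
            s ≤ Zhang2014.kolyvaginIndex W p ℓ) →
          ∃ Q : (W.baseChange (ringClassField K ι n)).toAffine.Point,
            ((p ^ s : ℕ) : ℤ) • Q = d.derivedPoint)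
    (hSig : ∀ (W : WeierstrassCurve ℚ) [W.IsElliptic] [W.IsGloballyMinimal] (N : ℕ) [NeZero N]
      (K : Type) [Field K] [NumberField K]
      (Dt : ModularParametrizationData W N) (H : HeegnerDatum N (NumberField.discr K)) (ι : K →+* ℂ)
      (P : (W.baseChange K).toAffine.Point),
      ¬ W.HasCM → Addv W 3 → SubGss W 3 → W.analyticRank = 1 → W.conductorNorm ℤ = N →
      (∀ z ∈ Dt.L.lattice, ∃ w ∈ periodLattice Dt.f, z = Dt.c * w) →
      ¬ (∃ (q : ℕ) (_ : Fact q.Prime), q ∣ N ∧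
          padicValNat 3 W.tamagawaProduct ≤ padicValNat 3 ((W.baseChange ℚ_[q]).localTamagawaNumber ℤ_[q])) →
      IsImaginaryQuadratic K → SatisfiesHeegnerHypothesis N K →
      (W.quadraticTwist (NumberField.discr K : ℚ)).entireLFunction 1 ≠ 0 →
      (WeierstrassCurve.Affine.Point.map ι.toRatAlgHom) P = heegnerPointComplex Dt H →
      ¬ IsOfFinAddOrder P → Odd (NumberField.discr K) →
      ∀ (s' : ℕ), s' ≤ padicValNat 3 W.tamagawaProduct + padicValNat 3 Dt.c.natAbs →
      ∀ (n : ℕ) (d : KolyvaginHeegnerData Dt H.β ι n), Squarefree n →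
      (∀ ℓ ∈ n.primeFactors, Zhang2014.IsKolyvaginPrime N W K 3 ℓ ∧ s' ≤ Zhang2014.kolyvaginIndex W 3 ℓ) →
      Koly.PDiv d 3 s')
    (hL0 : Gss2LowerAtThreeRankZero)
    (W : WeierstrassCurve ℚ) [W.IsElliptic] [W.IsGloballyMinimal] [NeZero (W.conductorNorm ℤ)]
    (hCM : ¬ W.HasCM) (hadd : Addv W 3) (hsub : SubGss W 3) (hr : W.analyticRank = 1)
    (Dt : ModularParametrizationData W (W.conductorNorm ℤ))
    (hopt : ∀ z ∈ Dt.L.lattice, ∃ w ∈ periodLattice Dt.f, z = Dt.c * w) :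
    MissingUpperBoundAt W 3 := by
  by_cases hrow : ∃ (q : ℕ) (_ : Fact q.Prime), q ∣ W.conductorNorm ℤ ∧
      padicValNat 3 W.tamagawaProduct ≤ padicValNat 3 ((W.baseChange ℚ_[q]).localTamagawaNumber ℤ_[q])
  · obtain ⟨q, _, hqN, hmono⟩ := hrow
    exact leafRankOneUpper_three_monoCarrierAny_of_anyCarrierReading_of_lowerRankZero hGZ hKo hGZK hmod hGZ73 hMN hnf
      hFH hR₂ hL0 W hCM hadd hsub hr q hqN hmono Dt
      (not_three_dvd_c_of_latticeOptimal_of_subGss hM hAU hC2 hnf W Dt hopt hadd hsub)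
  · exact leafRankOneUpper_three_of_sigmaAtDatum_of_lowerRankZero hGZ hKo hGZK hmod hGZ73 hMN hnf hFH hL0 W hCM hadd
      hsub hr Dt (fun K _ _ H ι P hK hHN hLt hP hnt hodd s' hs' n d hn hℓ ↦
        hSig W (W.conductorNorm ℤ) K Dt H ι P hCM hadd hsub hr rfl hopt hrow hK hHN hLt hP hnt hodd s' hs' n d hn hℓ)

/-! ## §3 The route decl from PUB⁺ (by name) + R|₂ + Σ‴ + L₀, via the optimal member -/

/-- **`LeafRankOneUpperAtThree` ⟸ PUB⁺ + R|₂ + Σ‴ + L₀** (conclusion literally the route decl) — p639230 §5 with S2|₂ ↦ R|₂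
and Σ″ ↦ Σ‴: optimal member `W₀ ∼ W` (`exists_optimal_leaf_member`, modularity), §2 at `W₀`, transport back (Cassels + GZK).
PUB⁺ = item 27491 BY NAME; L₀ = item 26023 BY NAME. CONDITIONAL on every displayed input; U₁ stays OPEN; BSD is not proved.
[cite: Jetchev2008, Conj. 1.3, Thm. 1.4 (p. 812)] [cite: MatarNekovar2019, Thm. 0.7 (p. 456)] [cite: Mazur1978, Cor. 4.1]
[cite: MilneADT2006, Thm. I.7.3] [cite: EdixhovenManin1991, §1 and Prop. 2] [cite: FriedbergHoffstein1995, Thm. B]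
[cite: GrossZagier1986, Thm. I.(6.3) and (7.3)] [cite: Miller2011LMS, Def. 1.1] -/
theorem leafRankOneUpperAtThree_of_pubManin_of_anyCarrierReading_of_sigmaOptOffMonoRows_of_lowerRankZero
    (hpub : LeafRankOnePrintedInputsAtThree)
    (hR₂ : ∀ (W : WeierstrassCurve ℚ) [W.IsElliptic] [W.IsGloballyMinimal] [NeZero (W.conductorNorm ℤ)],
      ¬ W.HasCM →
      ∀ (K : Type) [Field K] [NumberField K], IsImaginaryQuadratic K →
      NumberField.discr K ≠ -3 → NumberField.discr K ≠ -4 →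
      SatisfiesHeegnerHypothesis (W.conductorNorm ℤ) K → SatisfiesHeegnerHypothesis 2 K →
      ∀ (p : ℕ) [Fact p.Prime], p ≠ 2 → Addv W p → W.HasIrreducibleModPGaloisRep p →
      ∀ (Dt : ModularParametrizationData W (W.conductorNorm ℤ)) (β : ℤ) (ι : K →+* ℂ)
        (d₁ : KolyvaginHeegnerData Dt β ι 1), ¬ IsOfFinAddOrder d₁.derivedPoint →
      ∀ (q : ℕ) [Fact q.Prime], q ∣ W.conductorNorm ℤ →
      ∀ (s : ℕ), s ≤ padicValNat p ((W.baseChange ℚ_[q]).localTamagawaNumber ℤ_[q]) →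
        ∀ (n : ℕ) (d : KolyvaginHeegnerData Dt β ι n), Squarefree n →
          (∀ ℓ ∈ n.primeFactors, Zhang2014.IsKolyvaginPrime (W.conductorNorm ℤ) W K p ℓ ∧
            s ≤ Zhang2014.kolyvaginIndex W p ℓ) →
          ∃ Q : (W.baseChange (ringClassField K ι n)).toAffine.Point,
            ((p ^ s : ℕ) : ℤ) • Q = d.derivedPoint)
    (hSig : ∀ (W : WeierstrassCurve ℚ) [W.IsElliptic] [W.IsGloballyMinimal] (N : ℕ) [NeZero N]
      (K : Type) [Field K] [NumberField K]
      (Dt : ModularParametrizationData W N) (H : HeegnerDatum N (NumberField.discr K)) (ι : K →+* ℂ)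
      (P : (W.baseChange K).toAffine.Point),
      ¬ W.HasCM → Addv W 3 → SubGss W 3 → W.analyticRank = 1 → W.conductorNorm ℤ = N →
      (∀ z ∈ Dt.L.lattice, ∃ w ∈ periodLattice Dt.f, z = Dt.c * w) →
      ¬ (∃ (q : ℕ) (_ : Fact q.Prime), q ∣ N ∧
          padicValNat 3 W.tamagawaProduct ≤ padicValNat 3 ((W.baseChange ℚ_[q]).localTamagawaNumber ℤ_[q])) →
      IsImaginaryQuadratic K → SatisfiesHeegnerHypothesis N K →
      (W.quadraticTwist (NumberField.discr K : ℚ)).entireLFunction 1 ≠ 0 →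
      (WeierstrassCurve.Affine.Point.map ι.toRatAlgHom) P = heegnerPointComplex Dt H →
      ¬ IsOfFinAddOrder P → Odd (NumberField.discr K) →
      ∀ (s' : ℕ), s' ≤ padicValNat 3 W.tamagawaProduct + padicValNat 3 Dt.c.natAbs →
      ∀ (n : ℕ) (d : KolyvaginHeegnerData Dt H.β ι n), Squarefree n →
      (∀ ℓ ∈ n.primeFactors, Zhang2014.IsKolyvaginPrime N W K 3 ℓ ∧ s' ≤ Zhang2014.kolyvaginIndex W 3 ℓ) →
      Koly.PDiv d 3 s')
    (hL0 : Gss2LowerAtThreeRankZero) :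
    LeafRankOneUpperAtThree := by
  intro W _ _ hCM hadd hsub hr
  obtain ⟨hGZ, hKo, hGZK, hmod, hGZ73, hMN, hnf, hFH, -, hCassels, hM, hAU, hC2⟩ := hpub
  haveI : Fact (Nat.Prime 3) := ⟨Nat.prime_three⟩
  obtain ⟨W₀, hW₀, hW₀', N, hN0, D₀, hiso, hN₀, -, hopt, hCM₀, hadd₀, hsub₀, hr₀⟩ :=
    exists_optimal_leaf_member hnf W hCM hadd hsub
  haveI := hW₀
  haveI := hW₀'
  haveI := hN0
  -- settle U₁ at the optimal member `W₀`
  have h₀ : MissingUpperBoundAt W₀ 3 := by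
    subst hN₀
    exact leafRankOneUpper_three_of_latticeOptimal_of_anyCarrierReading_of_sigmaOptOffMonoRows_of_lowerRankZero hGZ hKo
      hGZK hmod hGZ73 hMN hnf hFH hM hAU hC2 hR₂ hSig hL0 W₀ hCM₀ hadd₀ hsub₀ (hr₀.trans hr) D₀ hopt
  -- and transport it back along `W ∼ W₀`
  exact missingUpperBoundAt_of_isIsogenous_of_analyticRank_le_one hCassels hGZK hmod (le_of_eq hr) hiso h₀

/-! ## §4 Σ★‴ ⟹ Σ‴ (weakening) and Σ★″ (item 27493) ⟹ Σ★‴ (fewer rows) -/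

/-- **Σ★‴ ⟹ Σ‴**, by weakening (drop the analytic-rank and twisted-`L` binders), exactly as p622097's
`sigmaOptOffRows_of_sigmaStarOptOffRows` for Σ★″ ⟹ Σ″. Σ★‴ := the orientation-free Σ-form global `3`-divisibility of the
derived Heegner points at the additive `3` on the leaf, at a lattice-optimal datum, OFF the mono-carrier rows of any
reduction type — no Manin clause, no `r_an` binder. [cite: Jetchev2008, Conj. 1.3 (p. 812)] -/
theorem sigmaOptOffMonoRows_of_sigmaStarOptOffMonoRows
    (hStar : ∀ (W : WeierstrassCurve ℚ) [W.IsElliptic] [W.IsGloballyMinimal] (N : ℕ) [NeZero N]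
      (K : Type) [Field K] [NumberField K]
      (Dt : ModularParametrizationData W N) (H : HeegnerDatum N (NumberField.discr K)) (ι : K →+* ℂ)
      (P : (W.baseChange K).toAffine.Point),
      ¬ W.HasCM → Addv W 3 → SubGss W 3 → W.conductorNorm ℤ = N →
      (∀ z ∈ Dt.L.lattice, ∃ w ∈ periodLattice Dt.f, z = Dt.c * w) →
      ¬ (∃ (q : ℕ) (_ : Fact q.Prime), q ∣ N ∧
          padicValNat 3 W.tamagawaProduct ≤ padicValNat 3 ((W.baseChange ℚ_[q]).localTamagawaNumber ℤ_[q])) →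
      IsImaginaryQuadratic K → SatisfiesHeegnerHypothesis N K →
      (WeierstrassCurve.Affine.Point.map ι.toRatAlgHom) P = heegnerPointComplex Dt H →
      ¬ IsOfFinAddOrder P → Odd (NumberField.discr K) →
      ∀ (s' : ℕ), s' ≤ padicValNat 3 W.tamagawaProduct + padicValNat 3 Dt.c.natAbs →
      ∀ (n : ℕ) (d : KolyvaginHeegnerData Dt H.β ι n), Squarefree n →
      (∀ ℓ ∈ n.primeFactors, Zhang2014.IsKolyvaginPrime N W K 3 ℓ ∧ s' ≤ Zhang2014.kolyvaginIndex W 3 ℓ) →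
      Koly.PDiv d 3 s') :
    ∀ (W : WeierstrassCurve ℚ) [W.IsElliptic] [W.IsGloballyMinimal] (N : ℕ) [NeZero N]
      (K : Type) [Field K] [NumberField K]
      (Dt : ModularParametrizationData W N) (H : HeegnerDatum N (NumberField.discr K)) (ι : K →+* ℂ)
      (P : (W.baseChange K).toAffine.Point),
      ¬ W.HasCM → Addv W 3 → SubGss W 3 → W.analyticRank = 1 → W.conductorNorm ℤ = N →
      (∀ z ∈ Dt.L.lattice, ∃ w ∈ periodLattice Dt.f, z = Dt.c * w) →
      ¬ (∃ (q : ℕ) (_ : Fact q.Prime), q ∣ N ∧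
          padicValNat 3 W.tamagawaProduct ≤ padicValNat 3 ((W.baseChange ℚ_[q]).localTamagawaNumber ℤ_[q])) →
      IsImaginaryQuadratic K → SatisfiesHeegnerHypothesis N K →
      (W.quadraticTwist (NumberField.discr K : ℚ)).entireLFunction 1 ≠ 0 →
      (WeierstrassCurve.Affine.Point.map ι.toRatAlgHom) P = heegnerPointComplex Dt H →
      ¬ IsOfFinAddOrder P → Odd (NumberField.discr K) →
      ∀ (s' : ℕ), s' ≤ padicValNat 3 W.tamagawaProduct + padicValNat 3 Dt.c.natAbs →
      ∀ (n : ℕ) (d : KolyvaginHeegnerData Dt H.β ι n), Squarefree n →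
      (∀ ℓ ∈ n.primeFactors, Zhang2014.IsKolyvaginPrime N W K 3 ℓ ∧ s' ≤ Zhang2014.kolyvaginIndex W 3 ℓ) →
      Koly.PDiv d 3 s' :=
  fun W _ _ N _ K _ _ Dt H ι P hCM hadd hsub _ hN hopt hrow hK hHN _ hP hnt hodd s' hs' n d hn hℓ ↦
    hStar W N K Dt H ι P hCM hadd hsub hN hopt hrow hK hHN hP hnt hodd s' hs' n d hn hℓ

/-- **Σ★″ (item 27493 `LeafSigmaStarDivisibilityAtThreeOptimalOffRows`, BY NAME) ⟹ Σ★‴**: a mono-MULTIPLICATIVE-carrier row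
(`∃ q ∥ N` carrying the `3`-part of `∏ c_ℓ`, all carriers multiplicative) is in particular a mono-carrier row, so Σ★‴ is asked
on a SUBSET of Σ★″'s rows. The new research stub of skeleton v8 is therefore at most as strong as the route's child 27493.
[cite: Jetchev2008, Conj. 1.3 (p. 812)] -/
theorem sigmaStarOptOffMonoRows_of_sigmaStarOptOffRows
    (hStar : LeafSigmaStarDivisibilityAtThreeOptimalOffRows) :
    ∀ (W : WeierstrassCurve ℚ) [W.IsElliptic] [W.IsGloballyMinimal] (N : ℕ) [NeZero N]
      (K : Type) [Field K] [NumberField K]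
      (Dt : ModularParametrizationData W N) (H : HeegnerDatum N (NumberField.discr K)) (ι : K →+* ℂ)
      (P : (W.baseChange K).toAffine.Point),
      ¬ W.HasCM → Addv W 3 → SubGss W 3 → W.conductorNorm ℤ = N →
      (∀ z ∈ Dt.L.lattice, ∃ w ∈ periodLattice Dt.f, z = Dt.c * w) →
      ¬ (∃ (q : ℕ) (_ : Fact q.Prime), q ∣ N ∧
          padicValNat 3 W.tamagawaProduct ≤ padicValNat 3 ((W.baseChange ℚ_[q]).localTamagawaNumber ℤ_[q])) →
      IsImaginaryQuadratic K → SatisfiesHeegnerHypothesis N K →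
      (WeierstrassCurve.Affine.Point.map ι.toRatAlgHom) P = heegnerPointComplex Dt H →
      ¬ IsOfFinAddOrder P → Odd (NumberField.discr K) →
      ∀ (s' : ℕ), s' ≤ padicValNat 3 W.tamagawaProduct + padicValNat 3 Dt.c.natAbs →
      ∀ (n : ℕ) (d : KolyvaginHeegnerData Dt H.β ι n), Squarefree n →
      (∀ ℓ ∈ n.primeFactors, Zhang2014.IsKolyvaginPrime N W K 3 ℓ ∧ s' ≤ Zhang2014.kolyvaginIndex W 3 ℓ) →
      Koly.PDiv d 3 s' := by
  intro W _ _ N _ K _ _ Dt H ι P hCM hadd hsub hN hopt hrow hK hHN hP hnt hodd s' hs' n d hn hℓ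
  refine hStar W N K Dt H ι P hCM hadd hsub hN hopt ?_ hK hHN hP hnt hodd s' hs' n d hn hℓ
  rintro ⟨⟨q, hq, hqN, -, hmono⟩, -⟩
  exact hrow ⟨q, hq, hqN, hmono⟩

/-! ## §5 HEADLINE: the route decl U₁ from PUB⁺ ∧ three named print facts ∧ Σ★‴ ∧ L₀ — skeleton v8's composition -/

/-- **`LeafRankOneUpperAtThree` (26022) ⟸ `LeafRankOnePrintedInputsAtThree` (27491) ∧ {Gross 1991 Prop. 3.7 (2), Poitou–Tate
duality for Selmer structures (∀ K), [GZ86 III (3.1)] image-free} ∧ Σ★‴ ∧ `Gss2LowerAtThreeRankZero` (26023)** — p639230's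
headline with the research residue Σ★″ (27493) replaced by the WEAKER Σ★‴ (off the mono-carrier rows of any reduction type;
§4: Σ★″ ⟹ Σ★‴). = §3 ∘ {`JetchevReadingAnyCarrier.anyCarrierTwoSplitReading_of_namedFacts`, §4}. CONDITIONAL on the named
facts (published results typed as `def … : Prop`), on Σ★‴ (research: the 238 multi-carrier rank-one Gss2 classes) and on L₀
(residual); nothing asserted about any curve; U₁ stays OPEN; BSD is not proved.
[cite: Jetchev2008, Thm. 1.4, Cor. 1.5, Conj. 1.3 (p. 812)] [cite: GrossLMS1991, Prop. 3.7 (2) (p. 240), §6 p. 245]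
[cite: MilneADT2006, Ch. I, Thm. 4.10(b)] [cite: GrossZagier1986, III (3.1)] [cite: MatarNekovar2019, Thm. 0.7 (p. 456)]
[cite: FriedbergHoffstein1995, Thm. B] [cite: Mazur1978, Cor. 4.1] [cite: Miller2011LMS, Def. 1.1] -/
theorem leafRankOneUpperAtThree_of_pubManin_of_namedFacts_of_sigmaStarOptOffMonoRows_of_lowerRankZero
    (hpub : LeafRankOnePrintedInputsAtThree)
    (h37 : GrossLMS1991.prop37_2_frobeniusCongruence)
    (hPT : ∀ (K : Type) [Field K] [NumberField K],
      Literature.NumberTheory.GaloisCohomology.poitouTate_selmerStructure_duality_conj K)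
    (hF1 : Gross1991_heegnerPoint_sub_ratTorsion_mem_E0_imageFree)
    (hStar : ∀ (W : WeierstrassCurve ℚ) [W.IsElliptic] [W.IsGloballyMinimal] (N : ℕ) [NeZero N]
      (K : Type) [Field K] [NumberField K]
      (Dt : ModularParametrizationData W N) (H : HeegnerDatum N (NumberField.discr K)) (ι : K →+* ℂ)
      (P : (W.baseChange K).toAffine.Point),
      ¬ W.HasCM → Addv W 3 → SubGss W 3 → W.conductorNorm ℤ = N →
      (∀ z ∈ Dt.L.lattice, ∃ w ∈ periodLattice Dt.f, z = Dt.c * w) →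
      ¬ (∃ (q : ℕ) (_ : Fact q.Prime), q ∣ N ∧
          padicValNat 3 W.tamagawaProduct ≤ padicValNat 3 ((W.baseChange ℚ_[q]).localTamagawaNumber ℤ_[q])) →
      IsImaginaryQuadratic K → SatisfiesHeegnerHypothesis N K →
      (WeierstrassCurve.Affine.Point.map ι.toRatAlgHom) P = heegnerPointComplex Dt H →
      ¬ IsOfFinAddOrder P → Odd (NumberField.discr K) →
      ∀ (s' : ℕ), s' ≤ padicValNat 3 W.tamagawaProduct + padicValNat 3 Dt.c.natAbs →
      ∀ (n : ℕ) (d : KolyvaginHeegnerData Dt H.β ι n), Squarefree n →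
      (∀ ℓ ∈ n.primeFactors, Zhang2014.IsKolyvaginPrime N W K 3 ℓ ∧ s' ≤ Zhang2014.kolyvaginIndex W 3 ℓ) →
      Koly.PDiv d 3 s')
    (hL0 : Gss2LowerAtThreeRankZero) :
    LeafRankOneUpperAtThree :=
  leafRankOneUpperAtThree_of_pubManin_of_anyCarrierReading_of_sigmaOptOffMonoRows_of_lowerRankZero hpub
    (JetchevReadingAnyCarrier.anyCarrierTwoSplitReading_of_namedFacts h37 hPT hF1)
    (sigmaOptOffMonoRows_of_sigmaStarOptOffMonoRows hStar) hL0

end Summit.BirchSwinnertonDyer.BirchSwinnertonDyer.Theorems.RamifiedPairUpperBound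

end
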